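import Summits.HubbardSuperconductivity.HubbardSuperconductivity.Theorems.ThermalWedgeTwSourcedCondensationEngineReduction
import Summits.HubbardSuperconductivity.HubbardSuperconductivity.Theorems.ThermalWedgeTwSourcedCondensationDiscSlackOfCumulantComparison
import Literature.MathematicalPhysics.QuantumLattice.DWaveSourceFreeCumulantBound
import Literature.MathematicalPhysics.QuantumLattice.ComplexSourceCumulantBound

/-!
# Route `ThermalWedge`, crux `TwSourcedCondensation` (item `stmt-HubbardSuperconductivity-1697`):
# skeleton of line `zero-source-pair-cumulants` (crux-strategist, wall-breaker gen 1, 2026-08-17)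

THE LINE IN ONE SENTENCE. Nothing at NONZERO source is needed for this crux: the sourced engine input
(A) (two-sided disc slack, hypothesis 1 of the LANDED `twSourcedCondensation_of_engine`, p99571) follows by
complex analysis ALREADY in the tree (`Literature.Analysis.Complex.LogTaylorContinuation`,
`ComplexSourceCumulantBound`, free certificate `dWaveSource_free_pairCumulantBound`) from a comparison of the
ZERO-SOURCE pair-field cumulants of the interacting and the free torus — the β-uniform (`U log β ≤ a`) form
of the fixed-temperature theorem `DWaveSourceTorusComplexSourceDisc`
(`‖(m!)⁻¹[(log Z_L(U,·))⁽ᵐ⁾(0) − (log Z_L(0,·))⁽ᵐ⁾(0)]‖ ≤ (3/2)L²Aϱ^{m+1}|U|`, ϱ = ϱ(β)); the thermal input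
is the zero-source heat chord (B) as in the engine skeleton. So the whole crux is a statement about the
UNSOURCED weakly repulsive torus: its `d`-wave–smeared, zero-frequency `2m`-leg kernels compared with the
free ones (stub 1), plus its specific-heat sector (stub 3) — the native output currency of a
Benfatto–Giuliani–Mastropietro-type one-cutoff multiscale expansion, with NO Nambu propagator and NO
last-scale source.

Stubs (sorry ONLY here):
* `stub_pairCumulantComparison` (K_c) — ENGINE, h = 0, generating-functional currency: for `[μ₁,μ₂] ⊂ (−4,0)`
  `∃ B ∀ η ∃ U₀ a K`: `‖(m!)⁻¹[a_m(U) − a_m(0)]‖ ≤ (η log β + K)·βL²·(Bβ)^{m−2}` for all `m ≥ 2`,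
  `0 < U ≤ U₀`, `1 ≤ β ≤ e^{a/U}`, `μ ∈ [μ₁,μ₂]`, eventually in `L`, where
  `a_m(u) := (log Z_L(u,·))⁽ᵐ⁾(0)`, `Z_L(u,z) = tr e^{-β(hubbardTorusWith 2 L 1 u μ − z(Δ_d + Δ_d†))}`;
* `stub_discSlack_of_pairCumulantComparison` — the BRIDGE (K_c) → (A): provable NOW (free absolute bound
  `dWaveSource_free_pairCumulantBound` with `B₀ = 16` ⇒ absolute bound for `U` by the triangle inequality ⇒
  both `log Z_L(u,·)` are represented by their Taylor series on the complex disc `‖z‖ < 1/(max(B,16)β)`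
  (`eqOn_cexp_tsum_of_taylor_bound`, zero-free) ⇒ `D_L(β,h)·βL² = Re Σ_{m≥2}[a_m(U) − a_m(0)]h^m`
  ⇒ `|D_L| ≤ (η log β + K)h²/(1 − κ²B̄²)` on `|h| ≤ κ/β`, `κ = 1/(2 max(B,16))`; odd `m` are harmless);
* `stub_engineHeatChordSlack` (B) — ENGINE, h = 0 thermodynamics (verbatim hypothesis 2 of
  `twSourcedCondensation_of_engine`; shared with skeleton `entropy_staircase_linear_regime_c1`).
Composition `TwSourcedCondensation_of` = `twSourcedCondensation_of_engine (bridge K_c) B` — kernel-checked.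

SKELETON v2 (lead seat c6, 2026-08-17): the bridge stub is CLOSED — `stub_discSlack_of_pairCumulantComparison`
below is now a one-line invocation of the LANDED theorem
`Summit.HubbardSuperconductivity.HubbardSuperconductivity.Theorems.stub_discSlack_of_pairCumulantComparison`
(p137714, `Theorems/ThermalWedgeTwSourcedCondensationDiscSlackOfCumulantComparison.lean`, κ = 1/(2(B+B₀)),
comparison used at η/2, K ↦ 2K). Open stubs: (K_c) and (B) — both zero-source ENGINE statements; no
statement at nonzero source remains anywhere in the reduction of cruxes 1696/1697.
Census / card: `Cruxes/TwSourcedCondensation/STRATEGY-CENSUS.md`, `Lines/zero-source-pair-cumulants.md`.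
-/

noncomputable section

namespace Summit.HubbardSuperconductivity.HubbardSuperconductivity.Cruxes.TwSourcedCondensation.ZeroSourcePairCumulants

open scoped Nat
open Matrix Finset Literature.MathematicalPhysics.QuantumLattice
open Summit.HubbardSuperconductivity.HubbardSuperconductivity.Theses.ThermalWedge
open Summit.HubbardSuperconductivity.HubbardSuperconductivity.Theorems

/-- **Stub 1 (K_c): zero-source pair-field cumulant COMPARISON in the window `U log β ≤ a`** — the
interaction correction to every `m!`-normalised imaginary-time-ordered cumulant of the macroscopic `d`-wave
pair field `∫₀^β(Δ_d + Δ_d†)(τ)dτ` of the UNSOURCED torus is `≤ (η log β + K)·βL²·(Bβ)^{m-2}`, uniformly in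
the volume (ENGINE; the β-uniform form of `DWaveSourceTorusComplexSourceDisc`; constructive, not in print at
general filling). -/
theorem stub_pairCumulantComparison :
    ∀ μ₁ μ₂ : ℝ, -4 < μ₁ → μ₁ ≤ μ₂ → μ₂ < 0 → ∃ B : ℝ, 0 < B ∧ ∀ η : ℝ, 0 < η → ∃ U₀ a K : ℝ, 0 < U₀ ∧ 0 < a ∧ 0 < K ∧ ∀ U : ℝ, 0 < U → U ≤ U₀ → ∀ β : ℝ, 1 ≤ β → β ≤ Real.exp (a / U) → ∀ μ ∈ Set.Icc μ₁ μ₂, ∃ L₀ : ℕ, ∀ (L : ℕ) [NeZero L], L₀ ≤ L → ∀ m : ℕ, 2 ≤ m → ‖((Nat.factorial m : ℂ))⁻¹ * (iteratedDeriv m (fun z : ℂ => Complex.log (Matrix.partitionFn β (Literature.MathematicalPhysics.QuantumLattice.hubbardTorusWith 2 L 1 U μ - z • (Literature.MathematicalPhysics.QuantumLattice.pairField Literature.MathematicalPhysics.QuantumLattice.dWaveFormFactor L + (Literature.MathematicalPhysics.QuantumLattice.pairField Literature.MathematicalPhysics.QuantumLattice.dWaveFormFactor L)ᴴ)))) 0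 - iteratedDeriv m (fun z : ℂ => Complex.log (Matrix.partitionFn β (Literature.MathematicalPhysics.QuantumLattice.hubbardTorusWith 2 L 1 0 μ - z • (Literature.MathematicalPhysics.QuantumLattice.pairField Literature.MathematicalPhysics.QuantumLattice.dWaveFormFactor L + (Literature.MathematicalPhysics.QuantumLattice.pairField Literature.MathematicalPhysics.QuantumLattice.dWaveFormFactor L)ᴴ)))) 0)‖ ≤ (η * Real.log β + K) * (β * (L : ℝ) ^ 2) * (B * β) ^ (m - 2) := by
  sorry

/-- **Stub 2 (bridge, CLOSED p137714): zero-source cumulant comparison ⇒ the two-sided disc slack (A)**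
(hypothesis 1 of `Theorems.twSourcedCondensation_of_engine`), by the Taylor interface of
`LogTaylorContinuation` / `ComplexSourceCumulantBound` and the free certificate
`dWaveSource_free_pairCumulantBound`: `κ := 1/(2(B + B₀))`. Landed as
`Theorems.stub_discSlack_of_pairCumulantComparison`; kept here under its registered name. -/
theorem stub_discSlack_of_pairCumulantComparison :
    (∀ μ₁ μ₂ : ℝ, -4 < μ₁ → μ₁ ≤ μ₂ → μ₂ < 0 → ∃ B : ℝ, 0 < B ∧ ∀ η : ℝ, 0 < η → ∃ U₀ a K : ℝ, 0 < U₀ ∧ 0 < a ∧ 0 < K ∧ ∀ U : ℝ, 0 < U → U ≤ U₀ → ∀ β : ℝ, 1 ≤ β → β ≤ Real.exp (a / U) → ∀ μ ∈ Set.Icc μ₁ μ₂, ∃ L₀ : ℕ, ∀ (L : ℕ) [NeZero L], L₀ ≤ L → ∀ m : ℕ, 2 ≤ m → ‖((Nat.factorial m : ℂ))⁻¹ * (iteratedDeriv m (fun z : ℂ => Complex.log (Matrix.partitionFn β (Literature.MathematicalPhysics.QuantumLattice.hubbardTorusWith 2 L 1 U μ - z • (Literature.MathematicalPhysics.QuantumLattice.pairField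 Literature.MathematicalPhysics.QuantumLattice.dWaveFormFactor L + (Literature.MathematicalPhysics.QuantumLattice.pairField Literature.MathematicalPhysics.QuantumLattice.dWaveFormFactor L)ᴴ)))) 0 - iteratedDeriv m (fun z : ℂ => Complex.log (Matrix.partitionFn β (Literature.MathematicalPhysics.QuantumLattice.hubbardTorusWith 2 L 1 0 μ - z • (Literature.MathematicalPhysics.QuantumLattice.pairField Literature.MathematicalPhysics.QuantumLattice.dWaveFormFactor L + (Literature.MathematicalPhysics.QuantumLattice.pairField Literature.MathematicalPhysics.QuantumLattice.dWaveFormFactor L)ᴴ)))) 0)‖ ≤ (η * Real.log β + K) * (β * (L : ℝ) ^ 2) * (B * β) ^ (m - 2)) →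
    (∀ μ₁ μ₂ : ℝ, -4 < μ₁ → μ₁ ≤ μ₂ → μ₂ < 0 → ∃ κ : ℝ, 0 < κ ∧ ∀ η : ℝ, 0 < η → ∃ U₀ a K : ℝ, 0 < U₀ ∧ 0 < a ∧ 0 < K ∧ ∀ U : ℝ, 0 < U → U ≤ U₀ → ∀ β : ℝ, 1 ≤ β → β ≤ Real.exp (a / U) → ∀ μ ∈ Set.Icc μ₁ μ₂, ∃ L₀ : ℕ, ∀ (L : ℕ) [NeZero L], L₀ ≤ L → ∀ h : ℝ, |h| ≤ κ / β → |(Real.log (Matrix.partitionFn β (Literature.MathematicalPhysics.QuantumLattice.dWaveSourceTorus L U μ h)).re / (β * (L : ℝ) ^ 2) - Real.log (Matrix.partitionFn β (Literature.MathematicalPhysics.QuantumLattice.dWaveSourceTorus L 0 μ h)).re / (β * (L : ℝ) ^ 2)) - (Real.log (Matrix.partitionFn β (Literature.MathematicalPhysics.QuantumLattice.dWaveSourceTorus L U μ 0)).re / (β * (L : ℝ) ^ 2) - Real.log (Matrix.partitionFn β (Literature.MathematicalPhysics.QuantumLattice.dWaveSourceTorus L 0 μ 0)).re / (β * (L : ℝ)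 ^ 2))| ≤ (η * Real.log β + K) * h ^ 2) :=
  Summit.HubbardSuperconductivity.HubbardSuperconductivity.Theorems.stub_discSlack_of_pairCumulantComparison

/-- **Stub 3 (B): engine heat-chord slack at zero source** (verbatim hypothesis 2 of
`Theorems.twSourcedCondensation_of_engine`; ENGINE, h = 0 thermodynamics). -/
theorem stub_engineHeatChordSlack :
    ∀ μ₁ μ₂ : ℝ, -4 < μ₁ → μ₁ ≤ μ₂ → μ₂ < 0 → ∀ η : ℝ, 0 < η → ∃ U₀ a K' : ℝ, 0 < U₀ ∧ 0 < a ∧ 0 < K' ∧ ∀ U : ℝ, 0 < U → U ≤ U₀ → ∀ β : ℝ, 2 ≤ β → β ≤ Real.exp (a / U) → ∀ μ ∈ Set.Icc μ₁ μ₂, ∃ L₀ : ℕ, ∀ (L : ℕ) [NeZero L], L₀ ≤ L → (Real.log (Matrix.partitionFn (β / 2) (Literature.MathematicalPhysics.QuantumLattice.dWaveSourceTorus L U μ 0)).re / (β / 2 * (L : ℝ) ^ 2) - Real.log (Matrix.partitionFn β (Literature.MathematicalPhysics.QuantumLattice.dWaveSourceTorus L U μ 0)).re / (β * (L : ℝ)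 ^ 2)) - (Real.log (Matrix.partitionFn (β / 2) (Literature.MathematicalPhysics.QuantumLattice.dWaveSourceTorus L 0 μ 0)).re / (β / 2 * (L : ℝ) ^ 2) - Real.log (Matrix.partitionFn β (Literature.MathematicalPhysics.QuantumLattice.dWaveSourceTorus L 0 μ 0)).re / (β * (L : ℝ) ^ 2)) ≤ (η * Real.log β + K') / β ^ 2 := by
  sorry

/-- **The crux from the three stubs** (composition = the landed `twSourcedCondensation_of_engine`, p99571). -/
theorem TwSourcedCondensation_of :
    (∀ μ₁ μ₂ : ℝ, -4 < μ₁ → μ₁ ≤ μ₂ → μ₂ < 0 → ∃ B : ℝ, 0 < B ∧ ∀ η : ℝ, 0 < η → ∃ U₀ a K : ℝ, 0 < U₀ ∧ 0 < a ∧ 0 < K ∧ ∀ U : ℝ, 0 < U → U ≤ U₀ → ∀ β : ℝ, 1 ≤ β → β ≤ Real.exp (a / U) → ∀ μ ∈ Set.Icc μ₁ μ₂, ∃ L₀ : ℕ, ∀ (L : ℕ) [NeZero L], L₀ ≤ L → ∀ m : ℕ, 2 ≤ m → ‖((Nat.factorial m : ℂ))⁻¹ * (iteratedDeriv m (fun z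 : ℂ => Complex.log (Matrix.partitionFn β (Literature.MathematicalPhysics.QuantumLattice.hubbardTorusWith 2 L 1 U μ - z • (Literature.MathematicalPhysics.QuantumLattice.pairField Literature.MathematicalPhysics.QuantumLattice.dWaveFormFactor L + (Literature.MathematicalPhysics.QuantumLattice.pairField Literature.MathematicalPhysics.QuantumLattice.dWaveFormFactor L)ᴴ)))) 0 - iteratedDeriv m (fun z : ℂ => Complex.log (Matrix.partitionFn β (Literature.MathematicalPhysics.QuantumLattice.hubbardTorusWith 2 L 1 0 μ - z • (Literature.MathematicalPhysics.QuantumLattice.pairField Literature.MathematicalPhysics.QuantumLattice.dWaveFormFactor L + (Literature.MathematicalPhysics.QuantumLattice.pairField Literature.MathematicalPhysics.QuantumLattice.dWaveFormFactor L)ᴴ)))) 0)‖ ≤ (η * Real.log β + K) * (β * (L : ℝ) ^ 2) * (B * β) ^ (m - 2)) →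
    ((∀ μ₁ μ₂ : ℝ, -4 < μ₁ → μ₁ ≤ μ₂ → μ₂ < 0 → ∃ B : ℝ, 0 < B ∧ ∀ η : ℝ, 0 < η → ∃ U₀ a K : ℝ, 0 < U₀ ∧ 0 < a ∧ 0 < K ∧ ∀ U : ℝ, 0 < U → U ≤ U₀ → ∀ β : ℝ, 1 ≤ β → β ≤ Real.exp (a / U) → ∀ μ ∈ Set.Icc μ₁ μ₂, ∃ L₀ : ℕ, ∀ (L : ℕ) [NeZero L], L₀ ≤ L → ∀ m : ℕ, 2 ≤ m → ‖((Nat.factorial m : ℂ))⁻¹ * (iteratedDeriv m (fun z : ℂ => Complex.log (Matrix.partitionFn β (Literature.MathematicalPhysics.QuantumLattice.hubbardTorusWith 2 L 1 U μ - z • (Literature.MathematicalPhysics.QuantumLattice.pairField Literature.MathematicalPhysics.QuantumLattice.dWaveFormFactor L + (Literature.MathematicalPhysics.QuantumLattice.pairField Literature.MathematicalPhysics.QuantumLattice.dWaveFormFactor L)ᴴ)))) 0 - iteratedDeriv m (fun z : ℂ => Complex.log (Matrix.partitionFn β (Literature.MathematicalPhysics.QuantumLattice.hubbardTorusWith 2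 L 1 0 μ - z • (Literature.MathematicalPhysics.QuantumLattice.pairField Literature.MathematicalPhysics.QuantumLattice.dWaveFormFactor L + (Literature.MathematicalPhysics.QuantumLattice.pairField Literature.MathematicalPhysics.QuantumLattice.dWaveFormFactor L)ᴴ)))) 0)‖ ≤ (η * Real.log β + K) * (β * (L : ℝ) ^ 2) * (B * β) ^ (m - 2)) → (∀ μ₁ μ₂ : ℝ, -4 < μ₁ → μ₁ ≤ μ₂ → μ₂ < 0 → ∃ κ : ℝ, 0 < κ ∧ ∀ η : ℝ, 0 < η → ∃ U₀ a K : ℝ, 0 < U₀ ∧ 0 < a ∧ 0 < K ∧ ∀ U : ℝ, 0 < U → U ≤ U₀ → ∀ β : ℝ, 1 ≤ β → β ≤ Real.exp (a / U) → ∀ μ ∈ Set.Icc μ₁ μ₂, ∃ L₀ : ℕ, ∀ (L : ℕ) [NeZero L], L₀ ≤ L → ∀ h : ℝ, |h| ≤ κ / β → |(Real.log (Matrix.partitionFn β (Literature.MathematicalPhysics.QuantumLattice.dWaveSourceTorus L U μ h)).re / (β * (L : ℝ) ^ 2) - Real.log (Matrix.partitionFn β (Literature.MathematicalPhysics.QuantumLattice.dWaveSourceTorus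 L 0 μ h)).re / (β * (L : ℝ) ^ 2)) - (Real.log (Matrix.partitionFn β (Literature.MathematicalPhysics.QuantumLattice.dWaveSourceTorus L U μ 0)).re / (β * (L : ℝ) ^ 2) - Real.log (Matrix.partitionFn β (Literature.MathematicalPhysics.QuantumLattice.dWaveSourceTorus L 0 μ 0)).re / (β * (L : ℝ) ^ 2))| ≤ (η * Real.log β + K) * h ^ 2)) →
    (∀ μ₁ μ₂ : ℝ, -4 < μ₁ → μ₁ ≤ μ₂ → μ₂ < 0 → ∀ η : ℝ, 0 < η → ∃ U₀ a K' : ℝ, 0 < U₀ ∧ 0 < a ∧ 0 < K' ∧ ∀ U : ℝ, 0 < U → U ≤ U₀ → ∀ β : ℝ, 2 ≤ β → β ≤ Real.exp (a / U) → ∀ μ ∈ Set.Icc μ₁ μ₂, ∃ L₀ : ℕ, ∀ (L : ℕ) [NeZero L], L₀ ≤ L → (Real.log (Matrix.partitionFn (β / 2) (Literature.MathematicalPhysics.QuantumLattice.dWaveSourceTorus L U μ 0)).re / (β / 2 * (L : ℝ) ^ 2) - Real.log (Matrix.partitionFn β (Literature.MathematicalPhysics.QuantumLattice.dWaveSourceTorus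 L U μ 0)).re / (β * (L : ℝ) ^ 2)) - (Real.log (Matrix.partitionFn (β / 2) (Literature.MathematicalPhysics.QuantumLattice.dWaveSourceTorus L 0 μ 0)).re / (β / 2 * (L : ℝ) ^ 2) - Real.log (Matrix.partitionFn β (Literature.MathematicalPhysics.QuantumLattice.dWaveSourceTorus L 0 μ 0)).re / (β * (L : ℝ) ^ 2)) ≤ (η * Real.log β + K') / β ^ 2) →
    TwSourcedCondensation :=
  fun hK hbridge hB => twSourcedCondensation_of_engine (hbridge hK) hB

/-- The same composition applied to the registered stubs. -/
theorem TwSourcedCondensation_of_stubs : TwSourcedCondensation :=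
  TwSourcedCondensation_of stub_pairCumulantComparison stub_discSlack_of_pairCumulantComparison
    stub_engineHeatChordSlack

/-- The sister crux closes from the SAME three stubs (`twSourcedInertness_of_engine`, same file p99571). -/
theorem TwSourcedInertness_of_stubs : TwSourcedInertness :=
  twSourcedInertness_of_engine (stub_discSlack_of_pairCumulantComparison stub_pairCumulantComparison)
    stub_engineHeatChordSlack

end Summit.HubbardSuperconductivity.HubbardSuperconductivity.Cruxes.TwSourcedCondensation.ZeroSourcePairCumulants
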